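import Summits.QuantumFields.BalabanUV.T4Continuum.Support.NE3CurlPairedResidualSpread
import HarnessLib

/-!
# T⁴ programme, node NE3 — row E-RES♯, sub-row R♯5, file (5d): (RES♯) IN THE CONSUMER's CURRENCY
# `CurlPairedResidual L k (cavg L U_B) T (C′·residualScale d L N b g k) (periodBox (N·L^k))` with a LEVEL-FREE `C′`

NE3 formalisation swarm, LEAF PROVER 02 (unit `b2b-balaban-t4-ne3-formalise-leaf-02`, gen 4; cell `pub-balaban`); row E-RES♯-R5.
File (5c) `NE3CurlPairedResidualSpread.curlPairedResidual_regular` proves (RES♯) with the DISPLAYED radius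
`r(k) = L^{4−d}·wallConst·[T₁(k)·(k₁ + c₂·a·L^k) + a²·K₄·√(d·(N·L^k)^d)·L^k]`, `a = b∕(L^{k+1})²`,
`T₁(k) = √(g·N^d·(L^{k+1})^d∕(L^{k+1})^6)`; the chart consumer `NE3EnergyRateWSupOfChart.ne3EnergyRateWSup_of_chartLeaves` wants the
radius in the form `C′·NE3EnergyShapes.residualScale d L N b g k` with ONE `C′ ≥ 0` for all levels.  THIS FILE supplies the comparison:
* `curlPairedResidual_mono` — `CurlPairedResidual` is monotone in the radius;
* `one_le_dualC2` (`d ≥ 2`, `L ≥ 1`); `mul_pow_le_of_le` bookkeeping `a·L^k ≤ b`;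
* `aux_sq_term_eq` — the `a²`-term IS `b²·K₄·√(d∕(g·L^{d+2}))·T₁(k)` EXACTLY (`g > 0`): the «a-weighted, harmless» extra factor `L^k` of
  the weighted currency is paid by the gradient budget `T₁(k)` at the SAME rate, level by level;
* **`radius_le_residualScale`** — `r(k) ≤ C′·residualScale d L N b g k` with the LEVEL-FREE
  `C′ = √(L^{d−2}) + c₂·b + b²·K₄·√(d∕(g·L^{d+2}))` (`c₂ = √(L^{d−2})·√(8·#Plane)·128dL² + 2·2048(d+4)²L²√(d·L^d)`, `K₄ = 2L^{d−1} + 16dL^d`);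
* **`curlPairedResidual_regular_residualScale`** — (RES♯) in the consumer's currency: for `d ≥ 2`, `g > 0`, in the setting of (5b)∕(5c),
  `CurlPairedResidual L (j+1) (cavg L U_B) T (C′·residualScale d L N b g (j+1)) (periodBox (N·L^{j+1}))`.
HONEST FRAMING.  Real arithmetic over (5c); `g > 0` is the generic case of `Regular` (for `g = 0` the `a²`-term of `r(k)` is NOT
dominated level-uniformly by `residualScale`, whose `a²`-term lacks the weighted-currency factor `L^k` — recorded, not hidden); (RES♯) ✓,
but T-E_w♯ needs (ML_w) at `W = cavg L U_B` (open off the flat background); NE3 NOT proved; spine PROVED 0∕9; finite T⁴ rung (B)+1 —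
NOT infinite volume, NOT mass gap, NOT `BetaPertH`, NOT Clay.  Context: [Balaban1985Variational] (26)–(27) p.282.
PLACEMENT: `Summits/QuantumFields/BalabanUV/`.  HONEST DEPENDENCY: continuum YM on T⁴ ⇐ BetaPertH ∧ nine spine estimates (0/9 proved);
BetaPertH ⇐ (D1) ∧ (D4) ∧ CAP+tail; G-an2-4 gates asym, D1 and NE2/3/4.
-/

set_option autoImplicit false

open scoped BigOperators Matrix Matrix.Norms.L2Operator
open NormedSpace Finset

namespace Summit.QuantumFields.BalabanUV.T4Continuum.NE3CurlPairedResidualScale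

open Literature.MathematicalPhysics.QuantumFieldTheory.Balaban1983to89
open B7Prop1Explicit B7Prop2Explicit MatrixLog UnitaryModel
open T4AveragingDeficitWall hiding Site Plane Plaq Bond
open T4AveragingDeficitWallBoundary (periodBox)
open AveragingDeficitPeriodicCounting (IsPeriodicDir)
open AveragingDeficitDerivWallProof (wallConst wallConst_nonneg)
open AveragingDeficitDualResidual (dualC1 dualC2)
open AveragingDeficitChartCalculus (cavg)
open AveragingDeficitMultiLevelPrep (LevelSmall TangentIter)
open MinimalActionSandwich (IsMinimiser)
open MinimalActionRate (Regular sfClass)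
open NE3EnergyShapes (residualScale dualC1_nonneg)
open NE3EnergyWeightedShapes (energyNormW energyNormW_nonneg CurlPairedResidual)
open NE3CurlPairedResidualSpread (curlPairedResidual_regular)

noncomputable section

variable {d : ℕ} {n : Type*} [Fintype n] [DecidableEq n]

/-! ## §1 Bookkeeping -/

/-- `CurlPairedResidual` is monotone in the radius. [folklore] -/
theorem curlPairedResidual_mono {L k : ℕ} {W : Site d → Fin d → (Matrix n n ℂ)ˣ} {T : Set (Site d → Fin d → Matrix n n ℂ)}
    {r r' : ℝ} {F : Finset (Site d)} (hrr : r ≤ r') (h : CurlPairedResidual L k W T r F) : CurlPairedResidual L k W T r' F :=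
  fun Y hY => (h Y hY).trans (mul_le_mul_of_nonneg_right hrr (energyNormW_nonneg L k W Y F))

omit [Fintype n] [DecidableEq n] in
/-- There is a plane when `d ≥ 2`. [folklore] -/
theorem card_plane_pos (hd : 2 ≤ d) : 0 < Fintype.card (T4AveragingDeficitWall.Plane d) :=
  Fintype.card_pos_iff.mpr ⟨⟨(⟨0, by omega⟩, ⟨1, by omega⟩), Fin.mk_lt_mk.mpr Nat.zero_lt_one⟩⟩

omit [Fintype n] [DecidableEq n] in
/-- `dualC2 d L = 2L^d·√(8·#Plane) ≥ 1` for `d ≥ 2`, `L ≥ 1`. [folklore] -/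
theorem one_le_dualC2 (hd : 2 ≤ d) {L : ℕ} (hL : 1 ≤ L) : 1 ≤ dualC2 d L := by
  unfold dualC2
  have hL1 : (1 : ℝ) ≤ L := by exact_mod_cast hL
  have hLd : (1 : ℝ) ≤ (L : ℝ) ^ d := one_le_pow₀ hL1
  have hP : (1 : ℝ) ≤ Fintype.card (T4AveragingDeficitWall.Plane d) := by exact_mod_cast card_plane_pos hd
  have h8 : (1 : ℝ) ≤ Real.sqrt (8 * Fintype.card (T4AveragingDeficitWall.Plane d)) := by
    rw [show (1 : ℝ) = Real.sqrt 1 from Real.sqrt_one.symm]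
    exact Real.sqrt_le_sqrt (by linarith)
  nlinarith

omit [Fintype n] [DecidableEq n] in
/-- `a·L^{j+1} ≤ b` for `a = b∕(L^{j+2})²`, `b ≥ 0`, `L ≥ 1`. [folklore] -/
theorem radius_mul_pow_le {L : ℕ} (hL : 1 ≤ L) (j : ℕ) {b : ℝ} (hb : 0 ≤ b) :
    b / ((L : ℝ) ^ (j + 2)) ^ 2 * (L : ℝ) ^ (j + 1) ≤ b := by
  have hL1 : (1 : ℝ) ≤ L := by exact_mod_cast hL
  have hP : (0 : ℝ) < ((L : ℝ) ^ (j + 2)) ^ 2 := by positivity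
  rw [div_mul_eq_mul_div, div_le_iff₀ hP]
  refine mul_le_mul_of_nonneg_left ?_ hb
  calc (L : ℝ) ^ (j + 1) ≤ (L : ℝ) ^ ((j + 2) * 2) := pow_le_pow_right₀ hL1 (by omega)
    _ = ((L : ℝ) ^ (j + 2)) ^ 2 := pow_mul _ _ _

omit [Fintype n] [DecidableEq n] in
/-- **THE `a²`-TERM IS THE GRADIENT BUDGET AT THE SAME RATE**: for `g > 0`, `L ≥ 1`,
`a²·√(d·(N·L^{j+1})^d)·L^{j+1} = b²·√(d∕(g·L^{d+2}))·√(g·N^d·(L^{j+2})^d∕(L^{j+2})^6)`, `a = b∕(L^{j+2})²`. [folklore] -/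
theorem aux_sq_term_eq {L N : ℕ} (hL : 1 ≤ L) (j : ℕ) (b : ℝ) {g : ℝ} (hg : 0 < g) :
    (b / ((L : ℝ) ^ (j + 2)) ^ 2) ^ 2 * Real.sqrt (d * ((N * L ^ (j + 1) : ℕ) : ℝ) ^ d) * (L : ℝ) ^ (j + 1)
      = b ^ 2 * Real.sqrt (d / (g * (L : ℝ) ^ (d + 2)))
          * Real.sqrt (g * (N : ℝ) ^ d * ((L : ℝ) ^ (j + 2)) ^ d / ((L : ℝ) ^ (j + 2)) ^ 6) := by
  have hL0 : (0 : ℝ) < L := by exact_mod_cast hL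
  have hA : 0 ≤ (b / ((L : ℝ) ^ (j + 2)) ^ 2) ^ 2 * (L : ℝ) ^ (j + 1) := by positivity
  have hB : (0 : ℝ) ≤ b ^ 2 := sq_nonneg b
  -- both sides as single square roots
  have lhs : (b / ((L : ℝ) ^ (j + 2)) ^ 2) ^ 2 * Real.sqrt (d * ((N * L ^ (j + 1) : ℕ) : ℝ) ^ d) * (L : ℝ) ^ (j + 1)
      = Real.sqrt (((b / ((L : ℝ) ^ (j + 2)) ^ 2) ^ 2 * (L : ℝ) ^ (j + 1)) ^ 2 * (d * ((N * L ^ (j + 1) : ℕ) : ℝ) ^ d)) := by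
    rw [Real.sqrt_mul (sq_nonneg _), Real.sqrt_sq hA]; ring
  have rhs : b ^ 2 * Real.sqrt (d / (g * (L : ℝ) ^ (d + 2)))
        * Real.sqrt (g * (N : ℝ) ^ d * ((L : ℝ) ^ (j + 2)) ^ d / ((L : ℝ) ^ (j + 2)) ^ 6)
      = Real.sqrt ((b ^ 2) ^ 2 * ((d / (g * (L : ℝ) ^ (d + 2)))
          * (g * (N : ℝ) ^ d * ((L : ℝ) ^ (j + 2)) ^ d / ((L : ℝ) ^ (j + 2)) ^ 6))) := by
    rw [Real.sqrt_mul (sq_nonneg _), Real.sqrt_sq hB, Real.sqrt_mul (by positivity)]; ring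
  rw [lhs, rhs]
  congr 1
  push_cast
  field_simp
  ring

/-! ## §2 The radius of (5c) against `residualScale` -/

/-- **`r(k) ≤ C′·residualScale d L N b g k`, LEVEL-FREE `C′`** (`k = j+1`; `d ≥ 2`, `L ≥ 1`, `b ≥ 0`, `g > 0`): the displayed radius of
`NE3CurlPairedResidualSpread.curlPairedResidual_regular` is at most
`(√(L^{d−2}) + c₂·b + b²·K₄·√(d∕(g·L^{d+2})))·residualScale d L N b g (j+1)`,
`c₂ = √(L^{d−2})·√(8·#Plane)·128dL² + 2·2048(d+4)²L²√(d·L^d)`, `K₄ = 2L^{d−1} + 2·8dL^d`. [folklore] -/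
theorem radius_le_residualScale (hd : 2 ≤ d) {L : ℕ} (hL : 1 ≤ L) (N j : ℕ) {b g : ℝ} (hb : 0 ≤ b) (hg : 0 < g) :
    (L : ℝ) ^ (4 - (d : ℤ)) * wallConst d L
          * (Real.sqrt (g * (N : ℝ) ^ d * ((L : ℝ) ^ (j + 2)) ^ d / ((L : ℝ) ^ (j + 2)) ^ 6)
              * (Real.sqrt ((L : ℝ) ^ (d - 2))
                + (Real.sqrt ((L : ℝ) ^ (d - 2)) * Real.sqrt (8 * Fintype.card (T4AveragingDeficitWall.Plane d))
                    * (128 * (d * (L : ℝ) ^ 2))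
                  + 2 * (2048 * ((d : ℝ) + 4) ^ 2 * (L : ℝ) ^ 2 * Real.sqrt (d * (L : ℝ) ^ d)))
                * (b / ((L : ℝ) ^ (j + 2)) ^ 2) * (L : ℝ) ^ (j + 1))
            + (b / ((L : ℝ) ^ (j + 2)) ^ 2) ^ 2 * (2 * (L : ℝ) ^ (d - 1) + 2 * (8 * d * (L : ℝ) ^ d))
              * Real.sqrt (d * ((N * L ^ (j + 1) : ℕ) : ℝ) ^ d) * (L : ℝ) ^ (j + 1))
      ≤ (Real.sqrt ((L : ℝ) ^ (d - 2))
            + (Real.sqrt ((L : ℝ) ^ (d - 2)) * Real.sqrt (8 * Fintype.card (T4AveragingDeficitWall.Plane d))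
                * (128 * (d * (L : ℝ) ^ 2))
              + 2 * (2048 * ((d : ℝ) + 4) ^ 2 * (L : ℝ) ^ 2 * Real.sqrt (d * (L : ℝ) ^ d))) * b
            + b ^ 2 * (2 * (L : ℝ) ^ (d - 1) + 2 * (8 * d * (L : ℝ) ^ d)) * Real.sqrt (d / (g * (L : ℝ) ^ (d + 2))))
        * residualScale d L N b g (j + 1) := by
  have hL0 : (0 : ℝ) < L := by exact_mod_cast hL
  -- names
  set Λ₀ : ℝ := (L : ℝ) ^ (4 - (d : ℤ)) * wallConst d L with hΛ₀
  set T₁ : ℝ := Real.sqrt (g * (N : ℝ) ^ d * ((L : ℝ) ^ (j + 2)) ^ d / ((L : ℝ) ^ (j + 2)) ^ 6) with hT₁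
  set a : ℝ := b / ((L : ℝ) ^ (j + 2)) ^ 2 with ha
  set S : ℝ := Real.sqrt (d * ((N * L ^ (j + 1) : ℕ) : ℝ) ^ d) with hS
  set k₁ : ℝ := Real.sqrt ((L : ℝ) ^ (d - 2)) with hk₁
  set c₂ : ℝ := Real.sqrt ((L : ℝ) ^ (d - 2)) * Real.sqrt (8 * Fintype.card (T4AveragingDeficitWall.Plane d))
      * (128 * (d * (L : ℝ) ^ 2)) + 2 * (2048 * ((d : ℝ) + 4) ^ 2 * (L : ℝ) ^ 2 * Real.sqrt (d * (L : ℝ) ^ d)) with hc₂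
  set K₄ : ℝ := 2 * (L : ℝ) ^ (d - 1) + 2 * (8 * d * (L : ℝ) ^ d) with hK₄
  set A₂ : ℝ := Real.sqrt (d / (g * (L : ℝ) ^ (d + 2))) with hA₂
  have hΛ : 0 ≤ Λ₀ := mul_nonneg (zpow_nonneg hL0.le _) (wallConst_nonneg d L)
  have hT : 0 ≤ T₁ := Real.sqrt_nonneg _
  have ha0 : 0 ≤ a := div_nonneg hb (by positivity)
  have hk : 0 ≤ k₁ := Real.sqrt_nonneg _
  have hc : 0 ≤ c₂ := by positivity
  have hK : 0 ≤ K₄ := by positivity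
  have hA : 0 ≤ A₂ := Real.sqrt_nonneg _
  have hS0 : 0 ≤ S := Real.sqrt_nonneg _
  -- the residual scale at level `j+1`, unfolded
  have hres : residualScale d L N b g (j + 1) = Λ₀ * (T₁ * dualC2 d L + a ^ 2 * dualC1 d L * S) := by
    unfold residualScale; rfl
  -- (i) the first bracket: `a·L^{j+1} ≤ b`
  have hi : k₁ + c₂ * a * (L : ℝ) ^ (j + 1) ≤ k₁ + c₂ * b := by
    have := mul_le_mul_of_nonneg_left (radius_mul_pow_le hL j hb) hc
    linarith [mul_assoc c₂ a ((L : ℝ) ^ (j + 1))]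
  -- (ii) the `a²`-term equals `b²·K₄·A₂·T₁`
  have hii : a ^ 2 * K₄ * S * (L : ℝ) ^ (j + 1) = b ^ 2 * K₄ * A₂ * T₁ := by
    have h := aux_sq_term_eq (d := d) (N := N) hL j b hg
    calc a ^ 2 * K₄ * S * (L : ℝ) ^ (j + 1) = K₄ * (a ^ 2 * S * (L : ℝ) ^ (j + 1)) := by ring
      _ = K₄ * (b ^ 2 * A₂ * T₁) := by rw [h]
      _ = b ^ 2 * K₄ * A₂ * T₁ := by ring
  -- the bracket of `r` is at most `C′·T₁ ≤ C′·T₁·dualC2 ≤ C′·(T₁·dualC2 + a²·dualC1·S)`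
  have hD2 : 1 ≤ dualC2 d L := one_le_dualC2 hd hL
  have hD1 : 0 ≤ a ^ 2 * dualC1 d L * S := mul_nonneg (mul_nonneg (sq_nonneg _) (dualC1_nonneg d L)) hS0
  have hC' : 0 ≤ k₁ + c₂ * b + b ^ 2 * K₄ * A₂ := by positivity
  have hbr : T₁ * (k₁ + c₂ * a * (L : ℝ) ^ (j + 1)) + a ^ 2 * K₄ * S * (L : ℝ) ^ (j + 1)
      ≤ (k₁ + c₂ * b + b ^ 2 * K₄ * A₂) * (T₁ * dualC2 d L + a ^ 2 * dualC1 d L * S) := by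
    rw [hii]
    have h1 : T₁ * (k₁ + c₂ * a * (L : ℝ) ^ (j + 1)) ≤ T₁ * (k₁ + c₂ * b) := mul_le_mul_of_nonneg_left hi hT
    have h2 : (k₁ + c₂ * b + b ^ 2 * K₄ * A₂) * T₁ ≤ (k₁ + c₂ * b + b ^ 2 * K₄ * A₂) * (T₁ * dualC2 d L) := by
      refine mul_le_mul_of_nonneg_left ?_ hC'
      have := mul_le_mul_of_nonneg_left hD2 hT
      linarith
    have h3 : (k₁ + c₂ * b + b ^ 2 * K₄ * A₂) * (T₁ * dualC2 d L)
        ≤ (k₁ + c₂ * b + b ^ 2 * K₄ * A₂) * (T₁ * dualC2 d L + a ^ 2 * dualC1 d L * S) :=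
      mul_le_mul_of_nonneg_left (le_add_of_nonneg_right hD1) hC'
    nlinarith
  rw [hres]
  calc Λ₀ * (T₁ * (k₁ + c₂ * a * (L : ℝ) ^ (j + 1)) + a ^ 2 * K₄ * S * (L : ℝ) ^ (j + 1))
      ≤ Λ₀ * ((k₁ + c₂ * b + b ^ 2 * K₄ * A₂) * (T₁ * dualC2 d L + a ^ 2 * dualC1 d L * S)) :=
        mul_le_mul_of_nonneg_left hbr hΛ
    _ = (k₁ + c₂ * b + b ^ 2 * K₄ * A₂) * (Λ₀ * (T₁ * dualC2 d L + a ^ 2 * dualC1 d L * S)) := by ring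

/-! ## §3 (RES♯) in the consumer's currency -/

/-- **(RES♯) IN THE CONSUMER's CURRENCY `C′·residualScale`.**  Setting of (5b)∕(5c) (`d ≥ 2`, `L, N ≥ 1`, `U_B` a minimiser of
`sfClass L N ε` at level `j+2` with datum `V`, `Regular d L N b g (j+2) U_B`, `0 ≤ b < ε`, `LevelSmall d L (j+1) (ε∕(L^{j+2})²)`) with
`g > 0`: for every set `T` of skew `(N·L^{j+1})`-periodic directions tangent to run A's fibre at `cavg L U_B`,
`CurlPairedResidual L (j+1) (cavg L U_B) T (C′·residualScale d L N b g (j+1)) (periodBox (N·L^{j+1}))` with the LEVEL-FREE `C′` of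
`radius_le_residualScale` — the hypothesis `hres` of `NE3EnergyRateWSupOfChart.ne3EnergyRateWSup_of_chartLeaves` at `k = j+1` for
any chart whose `T` consists of such directions. [folklore] -/
theorem curlPairedResidual_regular_residualScale [Nonempty n] (hd : 2 ≤ d) {L N : ℕ} [NeZero L] [NeZero N] (hL : 1 ≤ L)
    (hN : 1 ≤ N) (j : ℕ) {ε b g : ℝ} (hb : 0 ≤ b) (hbε : b < ε) (hg : 0 < g)
    (hsmall : LevelSmall d L (j + 1) (ε / ((L : ℝ) ^ (j + 2)) ^ 2))
    {V UB : Site d → Fin d → (Matrix n n ℂ)ˣ} (hB : IsMinimiser d (sfClass d L N ε) L N (j + 2) V UB)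
    (hreg : Regular d L N b g (j + 2) UB) {T : Set (Site d → Fin d → Matrix n n ℂ)}
    (hT : ∀ Y ∈ T, IsSkewDir Y ∧ IsPeriodicDir Y ((N * L ^ (j + 1) : ℕ) : ℤ) ∧ TangentIter L j (cavg L UB) Y) :
    CurlPairedResidual L (j + 1) (cavg L UB) T
      ((Real.sqrt ((L : ℝ) ^ (d - 2))
            + (Real.sqrt ((L : ℝ) ^ (d - 2)) * Real.sqrt (8 * Fintype.card (T4AveragingDeficitWall.Plane d))
                * (128 * (d * (L : ℝ) ^ 2))
              + 2 * (2048 * ((d : ℝ) + 4) ^ 2 * (L : ℝ) ^ 2 * Real.sqrt (d * (L : ℝ) ^ d))) * b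
            + b ^ 2 * (2 * (L : ℝ) ^ (d - 1) + 2 * (8 * d * (L : ℝ) ^ d)) * Real.sqrt (d / (g * (L : ℝ) ^ (d + 2))))
        * residualScale d L N b g (j + 1))
      (periodBox (N * L ^ (j + 1))) :=
  curlPairedResidual_mono (radius_le_residualScale (d := d) hd hL N j hb hg)
    (curlPairedResidual_regular hd hL hN j hb hbε hsmall hB hreg hT)

end

end Summit.QuantumFields.BalabanUV.T4Continuum.NE3CurlPairedResidualScale
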